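import Summits.Ventures.PercRepro.LemmaBPlusK5Def

/-!
# Faces of `K₅`: kernel slices 0 … 3 (part A)

Each theorem is one `decide +kernel` at default heartbeats (≈ 55 s: the 1024-row table of the marking
plus ≤ 22 000 face points in sub-mask loops); generated by `tools/gen_k5.py`.
-/

namespace PercRepro

namespace Examples

open MultiGraph

/-- Slice 0: joins `u ∈ [0, 179)` of the faces of `K₅` (21949 face points). -/
theorem k5_slice_0 : k5.FacesSRange ![0, 1, 2, 3] 0 179 := by decide +kernel

/-- Slice 1: joins `u ∈ [179, 239)` of the faces of `K₅` (20664 face points). -/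
theorem k5_slice_1 : k5.FacesSRange ![0, 1, 2, 3] 179 239 := by decide +kernel

/-- Slice 2: joins `u ∈ [239, 255)` of the faces of `K₅` (16362 face points). -/
theorem k5_slice_2 : k5.FacesSRange ![0, 1, 2, 3] 239 255 := by decide +kernel

/-- Slice 3: joins `u ∈ [255, 342)` of the faces of `K₅` (21909 face points). -/
theorem k5_slice_3 : k5.FacesSRange ![0, 1, 2, 3] 255 342 := by decide +kernel

end Examples

end PercRepro
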